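import Summits.BirchSwinnertonDyer.BirchSwinnertonDyer.Theorems.QuadraticBranchSignedControlPlusEtaNonsurjThetaFunctionalEquationParity
import Summits.BirchSwinnertonDyer.BirchSwinnertonDyer.Theorems.QuadraticBranchSignedControlPlusEtaNonsurjThetaFunctionalEquationCyclotomic
import Summits.BirchSwinnertonDyer.BirchSwinnertonDyer.Theorems.QuadraticBranchSignedControlPlusEtaNonsurjPlusCoeffCongruence
import Summits.BirchSwinnertonDyer.BirchSwinnertonDyer.Theorems.ResidualThetaTransportAtTwoPollackPairKUnique
import Summits.BirchSwinnertonDyer.BirchSwinnertonDyer.Theorems.QuadraticBranchSignedControlPlusEtaNonsurjMinusCoeffCongruenceMazur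
import Summits.BirchSwinnertonDyer.BirchSwinnertonDyer.Theorems.SignedLowerHalvesSmallImageLowerHalfBothSignsRttLayerLawUndepleted
import HarnessLib

/-!
# Route `QuadraticBranchSignedControl` (rung K8, cell `bsd-potss`), residual crux `PlusEtaMainConjectureNonsurj`
# (stmt-BirchSwinnertonDyer-19606): THE FUNCTIONAL EQUATION ON THE QUADRATIC BRANCH, V — the functional equation of the
# Mazur–Tate LIMITS and of EVERY `L_p^±(V, η, X)` modulo `T·ω^±_n·Λ`, and THE PARITY LAW `(−1)^{λ(L_p^±(V,η))} = σ·(−N | p)`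
# (`= w_V·η(−N_V) = w(W)`); `λ⁺ ≡ λ⁻ (mod 2)` sign-free (seat `bsd-potss-k8eta-c2` g27; kernel, class-wide)

WHY. Parts I–IV (p759560, p759988, p761320, p761322) proved the functional equation of the quadratic-branch Mazur–Tate elements
`ι Θ_n ≡ w(1+T)^{s_N}Θ_n (mod ω_nΛ)`, `w = σ·(−N | p)`, the generic parity mechanism, and the behaviour of `ω^±_n`, `ω_n` under `ι`.
THIS FILE assembles them on the objects every record of the crux is about — the tree's plus/minus branch functions
(`IsQuadraticBranchPlusLFunction f p ϖ L`, `IsQuadraticBranchMinusLFunction f p ϖ L`: Kobayashi's `L_p^±(V, η, X)` up to `ℤ_pˣ`):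
(§11) for the Mazur–Tate limits `M^±` (`θ_{2m}(η) ≡ ±ω⁻_{2m}M⁺ (mod ω_{2m})`, `θ_{2m+1}(η) ≡ ±ω⁺_{2m+1}M⁻ (mod ω_{2m+1})`, bsd-potss-ctrl)
and then for every branch function `L` (a unit multiple of `ϖM^±`, x1b's uniqueness):
`ι L − w·(1+T)^e·L ∈ T·ω⁺_{2m}·Λ` (plus) / `T·ω⁻_{2m+1}·Λ` (minus) for EVERY `m`; (§12) hence, choosing `m` with `deg ω^± > λ(L)`
(Part IV) and applying the parity lemma of Part III: **`(−1)^{λ(L)} = σ·(−N | p)` for every NONZERO `L_p^±(V, η, X)`** — no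
hypothesis on `μ(L)`, on the image of `ρ_{V,p}` (onto or not), on CM, or on the rank; and, eliminating the Fricke sign,
**`(−1)^{λ(L⁺)} = (−1)^{λ(L⁻)}`**; (§13) the same in the crux's row currency (`V` good at `p ≥ 5`, `a_p(V) = 0`, Mazur's
`‖ϖ‖_p ≤ 1` as the named fact `mazur_not_dvd_maninConstant_of_odd`, as in every record of the lineage). For the newform of `V` at
level `N_V`, `σ = w_V` and `σ·(−N_V | p) = w_V η(−N_V) = w(V ⊗ η) = w(W)`: the λ-invariants of both signed `p`-adic `L`-functions of
the η-branch have the parity of the analytic rank of the ADDITIVE PARTNER `W` — census P-27S/S3 (k8eta-c2 g27): `(−1)^{λ±} = ε(W)` on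
9129/9129 rows of the lineage's CM censuses at `p = 5, 7, 11` (g18's numerical law P2, now a theorem of the tree).

MATHEMATICS. §11 DESCENT ENGINE (`exists_invol_sub_eq_mul_of_congr`): from `Θ = εAM + Wq`, `ιΘ = cU^sΘ + Wq'`, `W = BA`,
`ιW = −WV^n`, `U^d ιA = A`, `A ≠ 0`, `ιε = ε`, `ε² = 1` (`U = 1+T`, `V = ι U = U⁻¹`): `A·ιM = εU^d(cU^sΘ + Wq') + εU^dWV^n ιq`, substitute
`Θ`, `W = BA`, cancel `A` in the domain `Λ` ⟹ `ιM − cU^{s+d}M ∈ BΛ`. Instances: plus `A = ω⁻_{2m}`, `B = Tω⁺_{2m}`, `W = ω_{2m} = Tω⁺ω⁻`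
(g24's integral congruence `exists_sub_eq_omega_mul_of_isCongrModOmega` + Part II's `exists_lift_invol_sub_sign_mul_eq_omega_mul`, the
two lifts agree by injectivity of `ℤ_p[T] → ℚ_p[T]`; Part IV's self-reciprocity of `ω⁻_{2m}` and `ιω_n = −ω_nV^{pⁿ}`); minus with `ω^±`
swapped. Every `L` is `v·ϖ·M^±` (`isQuadraticBranch{Plus,Minus}LFunction_one_of_isCongrModOmega[_even]`, `_C_mul`,
`exists_units_smul_eq`), and constants commute with `ι`. §12: `Tω^±_n ≡ T^{1+deg}` (mod p) with `deg ω⁺_{2m} ≥ m`, `deg ω⁻_{2m+1} ≥ m+1`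
(Part IV / tree), `p ∤ Tω^±_n`, so Part III's `neg_one_pow_lam_eq_of_invol_sub_eq_mul` applies at `m = λ(L) + 1` (plus) / `m = λ(L)` (minus).

WHAT. §11 `exists_invol_sub_eq_mul_of_congr`, `exists_invol_mazurTate{Plus,Minus}_sub_sign_mul_eq`,
`exists_invol_sub_sign_mul_eq_of_isQuadraticBranch{Plus,Minus}LFunction`; §12 `eq_one_or_eq_neg_one_of_sq_eq_one`, `sign_eq_one_or`,
**`neg_one_pow_lam_eq_sign_of_isQuadraticBranchPlusLFunction`**, **`neg_one_pow_lam_eq_sign_of_isQuadraticBranchMinusLFunction`**,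
**`neg_one_pow_lam_plus_eq_neg_one_pow_lam_minus`**; §13 `neg_one_pow_lam_plus_row`, `neg_one_pow_lam_minus_row`,
`neg_one_pow_lam_plus_eq_neg_one_pow_lam_minus_row`.

HONEST FRAMING (cell `bsd-potss`; FULL-BSD rank ≤ 1 programme, HUMAN RULING D-0036/D-0074): TOOL THEOREMS ONLY — no definition, no
named fact minted (§13 takes Mazur's Manin-constant fact `mazur_not_dvd_maninConstant_of_odd` in hypothesis position, exactly as the
lineage's records), no `sorry`, axioms standard; nothing about (A), (C1⁺_η), C-cc-1 or `BSD(W,p)` of any pair is claimed; no stub of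
19606 is proved; crux and route OPEN; nothing booked. `--supports stmt-BirchSwinnertonDyer-19606`.

References: [MazurTateTeitelbaum1986Invent] §I.17; [Kobayashi2003] Thm. 3.2, (3.4)–(3.7); [Pollack2003] Prop. 6.18; [GreenbergLNM1716]
§5; [Mazur1978] Cor. 4.1; [Washington1997] §7.1, §13.2. Tree: Parts I–IV; `…MinusCoeffCongruence{,Mazur}.lean` (g24),
`…PlusCoeffCongruence.lean` (g25), `Additive/QuadraticBranch{Plus,Minus}LFunction{Existence,Unique}.lean` (bsd-potss-ctrl, x1b),
`ResidualThetaTransportAtTwoPollackPairKUnique.lean`, `SignedLowerHalvesSmallImageLowerHalfBothSignsRttLayerLawUndepleted.lean`.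
-/

set_option autoImplicit false
set_option linter.dupNamespace false
noncomputable section

open scoped Classical MatrixGroups ModularForm

open CongruenceSubgroup Polynomial Literature.NumberTheory.EllipticCurves
  Literature.NumberTheory.EllipticCurves.ModularForms
open Literature.NumberTheory.EllipticCurves.IwasawaAlgebra
open Summit.BirchSwinnertonDyer.Rank1Residual.Additive
open Summit.BirchSwinnertonDyer.Rank1Residual.X1.MuLambda (lam)

namespace Summit.BirchSwinnertonDyer.BirchSwinnertonDyer.Theorems.EtaThetaFunctionalEquation

variable {p : ℕ} [hp : Fact p.Prime]

/-! ## §11 From the congruence `Θ ≡ ε·A·M (mod W)` and the functional equation of `Θ` to that of `M` -/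

omit hp in
/-- **The descent engine.** In `Λ`: if `Θ = ε A M + W q`, `ι Θ = c (1+T)^s Θ + W q'`, `W = B A`, `ι W = −W ι(1+T)^n`,
`(1+T)^d ι A = A` (self-reciprocity), `A ≠ 0`, `ι ε = ε`, `ε² = 1`, then `ι M − c (1+T)^{s+d} M ∈ B Λ`
(apply `ι`, multiply by `(1+T)^d`, substitute, cancel `A` in the domain `Λ`). [cite: MazurTateTeitelbaum1986Invent, §I.17] -/
theorem exists_invol_sub_eq_mul_of_congr [Fact p.Prime] {Θ M q q' A B W ε : PowerSeries ℤ_[p]} {c : ℤ_[p]}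
    {s d n : ℕ} (hid : Θ = ε * A * M + W * q)
    (hFE : invol p Θ = PowerSeries.C c * (1 + PowerSeries.X) ^ s * Θ + W * q')
    (hW : W = B * A) (hιW : invol p W = -W * (1 + invSubOne p) ^ n)
    (hA : (1 + PowerSeries.X : PowerSeries ℤ_[p]) ^ d * invol p A = A) (hA0 : A ≠ 0) (hιε : invol p ε = ε)
    (hεε : ε * ε = 1) :
    ∃ G : PowerSeries ℤ_[p],
      invol p M - PowerSeries.C c * (1 + PowerSeries.X) ^ (s + d) * M = B * G := by
  set U : PowerSeries ℤ_[p] := 1 + PowerSeries.X with hU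
  set V : PowerSeries ℤ_[p] := 1 + invSubOne p with hV
  have hUV : U * V = 1 := one_add_X_mul_one_add_invSubOne p
  have H1 : invol p Θ = ε * invol p A * invol p M + (-W * V ^ n) * invol p q := by
    rw [hid, map_add, map_mul, map_mul, map_mul, hιε, hιW]
  have h3 := H1.symm.trans hFE
  -- `A ιM = ε U^d (c U^s Θ + W q') + ε U^d W V^n ιq`
  have h4 : A * invol p M = ε * U ^ d * (PowerSeries.C c * U ^ s * Θ + W * q') + ε * U ^ d * W * V ^ n * invol p q := by
    linear_combination (ε * U ^ d) * h3 - (U ^ d * invol p A * invol p M) * hεε - invol p M * hA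
  refine ⟨ε * (U ^ d * V ^ n * invol p q + PowerSeries.C c * U ^ (s + d) * q + U ^ d * q'), ?_⟩
  have key : A * (invol p M - PowerSeries.C c * U ^ (s + d) * M -
      B * (ε * (U ^ d * V ^ n * invol p q + PowerSeries.C c * U ^ (s + d) * q + U ^ d * q'))) = 0 := by
    rw [pow_add]
    linear_combination h4 + (ε * PowerSeries.C c * U ^ s * U ^ d) * hid +
      (PowerSeries.C c * U ^ s * U ^ d * A * M) * hεε +
      (ε * PowerSeries.C c * U ^ s * U ^ d * q + ε * U ^ d * q' + ε * U ^ d * V ^ n * invol p q) * hW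
  exact sub_eq_zero.mp ((mul_eq_zero.mp key).resolve_left hA0)

section Branch

variable {N : ℕ} [NeZero N] {f : CuspForm (Gamma0 N) 2}

/-- **Functional equation of the plus Mazur–Tate limit `M⁺` modulo `T·ω⁺_{2m}·Λ`, every `m`.** For `p` odd, `f` a
rational newform of level `N` prime to `p` with `a_p(f) = 0` and Fricke sign `σ` (`w_N f = −σ f`), and `M ∈ Λ` with
`θ_{2m}(η) ≡ (−1)^{m+1}ω⁻_{2m}M (mod ω_{2m})` for all `m` (the tree's `M⁺`, `exists_isCongrModOmega_quadraticBranch_even`):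
`ι M − w·(1+T)^e·M ∈ T·ω⁺_{2m}·Λ` for some `e` (`= s_N + deg ω⁻_{2m}`), `w = σ·(−N | p)`.
[cite: MazurTateTeitelbaum1986Invent, §I.17] [cite: Pollack2003, Prop. 6.18] -/
theorem exists_invol_mazurTatePlus_sub_sign_mul_eq (hp2 : p ≠ 2) (hf0 : IsNewform0 f) (hQ : coeffField f = ⊥)
    (hpN : ¬ p ∣ N) (hap : cuspCoeff f p = ((0 : ℤ) : ℂ)) {σ : ℤ} (hσ : σ ^ 2 = 1)
    (hW : atkinLehnerInvolution N 2 N f = (-(σ : ℂ)) • f) {M : IwasawaAlgebra p}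
    (hM : ∀ m : ℕ, IsCongrModOmega p (2 * m) (quadraticBranchMazurTateElement p f (2 * m))
      ((-1) ^ (m + 1) * cyclotomicOmegaMinus p (2 * m)) M) (m : ℕ) :
    ∃ (e : ℕ) (G : PowerSeries ℤ_[p]),
      invol p M - PowerSeries.C ((σ * legendreSym p (-(N : ℤ)) : ℤ) : ℤ_[p]) * (1 + PowerSeries.X) ^ e * M =
        (((X * cyclotomicOmegaPlus p (2 * m)).map (Int.castRingHom ℤ_[p]) : ℤ_[p][X]) : PowerSeries ℤ_[p]) * G := by
  classical
  haveI := neZero_torsionOrder p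
  haveI := Fintype.ofFinite (rootsOfUnity (torsionOrder p) ℤ_[p])
  obtain ⟨ηN, sN, hν⟩ := exists_classMap_eq_natCast p (2 * m) hpN
  obtain ⟨Θ, q, hΘ, hid⟩ := EtaMinusCoeffCongruence.exists_sub_eq_omega_mul_of_isCongrModOmega hp2 hf0 hQ hpN hap (hM m)
  obtain ⟨Θ', q', hΘ', hFE⟩ := exists_lift_invol_sub_sign_mul_eq_omega_mul hp2 hf0 hQ hpN hap hσ hW (2 * m) hν
  have hΘΘ : Θ' = Θ :=
    Polynomial.map_injective _ (IsFractionRing.injective ℤ_[p] ℚ_[p]) (hΘ'.trans hΘ.symm)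
  rw [hΘΘ, sign_eq_mul_legendreSym_neg hp2 hpN hν] at hFE
  obtain ⟨d, hd⟩ := exists_pow_mul_invol_cyclotomicOmegaMinus (p := p) (2 * m)
  refine ⟨sN.val + d, exists_invol_sub_eq_mul_of_congr (ε := (-1) ^ (m + 1)) (n := p ^ (2 * m)) (q := q) (q' := q')
    (Θ := (Θ : PowerSeries ℤ_[p]))
    (W := (((cyclotomicOmega p (2 * m)).map (Int.castRingHom ℤ_[p]) : ℤ_[p][X]) : PowerSeries ℤ_[p])) ?_ ?_ ?_
    (invol_cyclotomicOmega (2 * m)) hd ?_ ?_ ?_⟩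
  · rw [← hid, Polynomial.map_mul, Polynomial.map_pow, Polynomial.map_neg, Polynomial.map_one, Polynomial.coe_mul,
      Polynomial.coe_pow, Polynomial.coe_neg, Polynomial.coe_one]
    ring
  · linear_combination hFE
  · rw [← X_mul_cyclotomicOmegaPlus_mul_cyclotomicOmegaMinus, Polynomial.map_mul, Polynomial.coe_mul]
  · rw [Ne, Polynomial.coe_eq_zero_iff]
    exact ((monic_cyclotomicOmegaMinus p (2 * m)).map _).ne_zero
  · rw [map_pow, map_neg, map_one]
  · rw [← pow_add, ← two_mul, pow_mul, neg_one_sq, one_pow]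

/-- **Functional equation of the minus Mazur–Tate limit `M⁻` modulo `T·ω⁻_{2m+1}·Λ`, every `m`** (twin of
`exists_invol_mazurTatePlus_sub_sign_mul_eq`: `θ_{2m+1}(η) ≡ (−1)^{m+1}ω⁺_{2m+1}M (mod ω_{2m+1})`, cancel `ω⁺_{2m+1}`).
[cite: MazurTateTeitelbaum1986Invent, §I.17] [cite: Pollack2003, Prop. 6.18] -/
theorem exists_invol_mazurTateMinus_sub_sign_mul_eq (hp2 : p ≠ 2) (hf0 : IsNewform0 f) (hQ : coeffField f = ⊥)
    (hpN : ¬ p ∣ N) (hap : cuspCoeff f p = ((0 : ℤ) : ℂ)) {σ : ℤ} (hσ : σ ^ 2 = 1)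
    (hW : atkinLehnerInvolution N 2 N f = (-(σ : ℂ)) • f) {M : IwasawaAlgebra p}
    (hM : ∀ m : ℕ, IsCongrModOmega p (2 * m + 1) (quadraticBranchMazurTateElement p f (2 * m + 1))
      ((-1) ^ (m + 1) * cyclotomicOmegaPlus p (2 * m + 1)) M) (m : ℕ) :
    ∃ (e : ℕ) (G : PowerSeries ℤ_[p]),
      invol p M - PowerSeries.C ((σ * legendreSym p (-(N : ℤ)) : ℤ) : ℤ_[p]) * (1 + PowerSeries.X) ^ e * M =
        (((X * cyclotomicOmegaMinus p (2 * m + 1)).map (Int.castRingHom ℤ_[p]) : ℤ_[p][X]) : PowerSeries ℤ_[p]) * G := by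
  classical
  haveI := neZero_torsionOrder p
  haveI := Fintype.ofFinite (rootsOfUnity (torsionOrder p) ℤ_[p])
  obtain ⟨ηN, sN, hν⟩ := exists_classMap_eq_natCast p (2 * m + 1) hpN
  obtain ⟨Θ, q, hΘ, hid⟩ := EtaMinusCoeffCongruence.exists_sub_eq_omega_mul_of_isCongrModOmega hp2 hf0 hQ hpN hap (hM m)
  obtain ⟨Θ', q', hΘ', hFE⟩ := exists_lift_invol_sub_sign_mul_eq_omega_mul hp2 hf0 hQ hpN hap hσ hW (2 * m + 1) hν
  have hΘΘ : Θ' = Θ :=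
    Polynomial.map_injective _ (IsFractionRing.injective ℤ_[p] ℚ_[p]) (hΘ'.trans hΘ.symm)
  rw [hΘΘ, sign_eq_mul_legendreSym_neg hp2 hpN hν] at hFE
  obtain ⟨d, hd⟩ := exists_pow_mul_invol_cyclotomicOmegaPlus (p := p) (2 * m + 1)
  refine ⟨sN.val + d, exists_invol_sub_eq_mul_of_congr (ε := (-1) ^ (m + 1)) (n := p ^ (2 * m + 1)) (q := q) (q' := q')
    (Θ := (Θ : PowerSeries ℤ_[p]))
    (W := (((cyclotomicOmega p (2 * m + 1)).map (Int.castRingHom ℤ_[p]) : ℤ_[p][X]) : PowerSeries ℤ_[p])) ?_ ?_ ?_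
    (invol_cyclotomicOmega (2 * m + 1)) hd ?_ ?_ ?_⟩
  · rw [← hid, Polynomial.map_mul, Polynomial.map_pow, Polynomial.map_neg, Polynomial.map_one, Polynomial.coe_mul,
      Polynomial.coe_pow, Polynomial.coe_neg, Polynomial.coe_one]
    ring
  · linear_combination hFE
  · rw [← X_mul_cyclotomicOmegaPlus_mul_cyclotomicOmegaMinus]
    simp only [Polynomial.map_mul, Polynomial.coe_mul]
    ring
  · rw [Ne, Polynomial.coe_eq_zero_iff]
    exact ((monic_cyclotomicOmegaPlus p (2 * m + 1)).map _).ne_zero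
  · rw [map_pow, map_neg, map_one]
  · rw [← pow_add, ← two_mul, pow_mul, neg_one_sq, one_pow]

/-- **Functional equation of EVERY plus branch function `L = L_p⁺(V, η, X)` modulo `T·ω⁺_{2m}·Λ`** (`‖ϖ‖_p ≤ 1`): `L` is a
unit multiple of `ϖ·M⁺` (x1b's uniqueness `IsQuadraticBranchPlusLFunction.exists_units_smul_eq`), so it inherits the functional
equation of `M⁺`: `ι L − w (1+T)^e L ∈ T·ω⁺_{2m}·Λ`, `w = σ·(−N | p)`. [cite: Kobayashi2003, Thm. 3.2, (3.4)]
[cite: MazurTateTeitelbaum1986Invent, §I.17] -/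
theorem exists_invol_sub_sign_mul_eq_of_isQuadraticBranchPlusLFunction (hp2 : p ≠ 2) (hf0 : IsNewform0 f)
    (hQ : coeffField f = ⊥) (hpN : ¬ p ∣ N) (hap : cuspCoeff f p = ((0 : ℤ) : ℂ)) {σ : ℤ} (hσ : σ ^ 2 = 1)
    (hW : atkinLehnerInvolution N 2 N f = (-(σ : ℂ)) • f) {ϖ : ℚ} (hϖ : ‖(ϖ : ℚ_[p])‖ ≤ 1)
    {L : IwasawaAlgebra p} (hL : IsQuadraticBranchPlusLFunction f p ϖ L) (m : ℕ) :
    ∃ (e : ℕ) (G : PowerSeries ℤ_[p]),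
      invol p L - PowerSeries.C ((σ * legendreSym p (-(N : ℤ)) : ℤ) : ℤ_[p]) * (1 + PowerSeries.X) ^ e * L =
        (((X * cyclotomicOmegaPlus p (2 * m)).map (Int.castRingHom ℤ_[p]) : ℤ_[p][X]) : PowerSeries ℤ_[p]) * G := by
  obtain ⟨M, hM⟩ := exists_isCongrModOmega_quadraticBranch_even hp2 hf0 hQ hpN hap
  have h1 : IsQuadraticBranchPlusLFunction f p 1 M :=
    EtaPlusCoeffCongruence.isQuadraticBranchPlusLFunction_one_of_isCongrModOmega_even hp2 hM
  set c : ℤ_[p] := ⟨(ϖ : ℚ_[p]), hϖ⟩ with hc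
  have h2 : IsQuadraticBranchPlusLFunction f p ϖ (PowerSeries.C c * M) := by
    have h := EtaPlusCoeffCongruence.isQuadraticBranchPlusLFunction_C_mul h1 c ϖ rfl
    rwa [mul_one] at h
  obtain ⟨v, hv⟩ := IsQuadraticBranchPlusLFunction.exists_units_smul_eq hp2 h2 hL
  obtain ⟨e, G, hG⟩ := exists_invol_mazurTatePlus_sub_sign_mul_eq hp2 hf0 hQ hpN hap hσ hW hM m
  refine ⟨e, PowerSeries.C ((v : ℤ_[p]) * c) * G, ?_⟩
  rw [hv, PowerSeries.smul_eq_C_mul, ← mul_assoc, ← map_mul]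
  rw [map_mul, invol_C]
  linear_combination (PowerSeries.C ((v : ℤ_[p]) * c)) * hG

/-- **Functional equation of EVERY minus branch function `L = L_p⁻(V, η, X)` modulo `T·ω⁻_{2m+1}·Λ`** (`‖ϖ‖_p ≤ 1`).
[cite: Kobayashi2003, Thm. 3.2, (3.5)] [cite: MazurTateTeitelbaum1986Invent, §I.17] -/
theorem exists_invol_sub_sign_mul_eq_of_isQuadraticBranchMinusLFunction (hp2 : p ≠ 2) (hf0 : IsNewform0 f)
    (hQ : coeffField f = ⊥) (hpN : ¬ p ∣ N) (hap : cuspCoeff f p = ((0 : ℤ) : ℂ)) {σ : ℤ} (hσ : σ ^ 2 = 1)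
    (hW : atkinLehnerInvolution N 2 N f = (-(σ : ℂ)) • f) {ϖ : ℚ} (hϖ : ‖(ϖ : ℚ_[p])‖ ≤ 1)
    {L : IwasawaAlgebra p} (hL : IsQuadraticBranchMinusLFunction f p ϖ L) (m : ℕ) :
    ∃ (e : ℕ) (G : PowerSeries ℤ_[p]),
      invol p L - PowerSeries.C ((σ * legendreSym p (-(N : ℤ)) : ℤ) : ℤ_[p]) * (1 + PowerSeries.X) ^ e * L =
        (((X * cyclotomicOmegaMinus p (2 * m + 1)).map (Int.castRingHom ℤ_[p]) : ℤ_[p][X]) : PowerSeries ℤ_[p]) * G := by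
  obtain ⟨M, hM⟩ := exists_isCongrModOmega_quadraticBranch_odd hp2 hf0 hQ hpN hap
  have h1 : IsQuadraticBranchMinusLFunction f p 1 M :=
    EtaMinusCoeffCongruence.isQuadraticBranchMinusLFunction_one_of_isCongrModOmega hp2 hf0 hQ hpN hap hM
  set c : ℤ_[p] := ⟨(ϖ : ℚ_[p]), hϖ⟩ with hc
  have h2 : IsQuadraticBranchMinusLFunction f p ϖ (PowerSeries.C c * M) := by
    have h := EtaMinusCoeffCongruence.isQuadraticBranchMinusLFunction_C_mul h1 c ϖ rfl
    rwa [mul_one] at h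
  obtain ⟨v, hv⟩ := IsQuadraticBranchMinusLFunction.exists_units_smul_eq hp2 h2 hL
  obtain ⟨e, G, hG⟩ := exists_invol_mazurTateMinus_sub_sign_mul_eq hp2 hf0 hQ hpN hap hσ hW hM m
  refine ⟨e, PowerSeries.C ((v : ℤ_[p]) * c) * G, ?_⟩
  rw [hv, PowerSeries.smul_eq_C_mul, ← mul_assoc, ← map_mul]
  rw [map_mul, invol_C]
  linear_combination (PowerSeries.C ((v : ℤ_[p]) * c)) * hG

/-! ## §12 THE PARITY LAW: `(−1)^{λ(L_p^±(V,η,X))} = σ · (−N | p)` (`= w(W)`) -/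

omit hp in
/-- `σ² = 1 ⇒ σ = ±1` in `ℤ`. [folklore] -/
theorem eq_one_or_eq_neg_one_of_sq_eq_one {σ : ℤ} (h : σ ^ 2 = 1) : σ = 1 ∨ σ = -1 := by
  have h2 : (σ - 1) * (σ + 1) = 0 := by linear_combination h
  rcases mul_eq_zero.mp h2 with h3 | h3
  · left; linarith
  · right; linarith

omit [NeZero N] in
/-- The sign `σ·(−N | p)` is `±1` (`p ∤ N`). [folklore] -/
theorem sign_eq_one_or (hpN : ¬ p ∣ N) {σ : ℤ} (hσ : σ ^ 2 = 1) :
    σ * legendreSym p (-(N : ℤ)) = 1 ∨ σ * legendreSym p (-(N : ℤ)) = -1 := by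
  have hN0 : ((-(N : ℤ) : ℤ) : ZMod p) ≠ 0 := by
    rw [Int.cast_neg, Int.cast_natCast, neg_ne_zero, Ne, ZMod.natCast_eq_zero_iff]; exact hpN
  rcases eq_one_or_eq_neg_one_of_sq_eq_one hσ with rfl | rfl <;>
    rcases legendreSym.eq_one_or_neg_one p hN0 with h | h <;> simp [h]

/-- **PARITY OF `λ⁺`.** For `p` odd, `f` a rational newform of level `N` prime to `p` with `a_p(f) = 0` and Fricke sign `σ`
(`w_N f = −σ f`), `‖ϖ‖_p ≤ 1`, and ANY nonzero `L` with `IsQuadraticBranchPlusLFunction f p ϖ L` (Kobayashi's `L_p⁺(V, η, X)`):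
`(−1)^{λ(L)} = σ · (−N | p)` — for the newform of the good `a_p = 0` twist `V` at level `N_V` the right-hand side is
`w_V · η(−N_V) = w(W)`, the root number of the additive partner `W = V^{(p*)}`. No hypothesis on `μ(L)`, on the image of
`ρ_{V,p}`, on CM, or on the rank. [cite: MazurTateTeitelbaum1986Invent, §I.17] [cite: GreenbergLNM1716, §5]
[cite: Kobayashi2003, Thm. 3.2, (3.4)] -/
theorem neg_one_pow_lam_eq_sign_of_isQuadraticBranchPlusLFunction (hp2 : p ≠ 2) (hf0 : IsNewform0 f)
    (hQ : coeffField f = ⊥) (hpN : ¬ p ∣ N) (hap : cuspCoeff f p = ((0 : ℤ) : ℂ)) {σ : ℤ} (hσ : σ ^ 2 = 1)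
    (hW : atkinLehnerInvolution N 2 N f = (-(σ : ℂ)) • f) {ϖ : ℚ} (hϖ : ‖(ϖ : ℚ_[p])‖ ≤ 1)
    {L : IwasawaAlgebra p} (hL : IsQuadraticBranchPlusLFunction f p ϖ L) (hL0 : L ≠ 0) :
    (-1 : ℤ) ^ lam L = σ * legendreSym p (-(N : ℤ)) := by
  have hP : p.Prime := hp.out
  set m : ℕ := lam L + 1 with hm
  obtain ⟨e, G, hG⟩ := exists_invol_sub_sign_mul_eq_of_isQuadraticBranchPlusLFunction hp2 hf0 hQ hpN hap hσ hW hϖ hL m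
  have hw := sign_eq_one_or (p := p) hpN hσ
  refine neg_one_pow_lam_eq_of_invol_sub_eq_mul hp2 hL0 hw (U := (1 + PowerSeries.X) ^ e)
    (by rw [map_pow, map_add, map_one, PowerSeries.constantCoeff_X, add_zero, one_pow]) (fun i hi ↦ ?_)
    (not_C_dvd_coe_X_mul_of_monic (monic_cyclotomicOmegaPlus p (2 * m))) hG
  exact dvd_coeff_coe_X_mul_of_map_zmod_eq (SmallImageRttOneSided.map_zmod_cyclotomicOmegaPlus (2 * m))
    (hi.trans ((Nat.le_succ _).trans (PollackPairK.le_natDegree_cyclotomicOmegaPlus p m)))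

/-- **PARITY OF `λ⁻`** (twin for Kobayashi's `L_p⁻(V, η, X)`): `(−1)^{λ(L)} = σ · (−N | p)` for every nonzero minus branch
function `L`. [cite: MazurTateTeitelbaum1986Invent, §I.17] [cite: GreenbergLNM1716, §5] [cite: Kobayashi2003, Thm. 3.2, (3.5)] -/
theorem neg_one_pow_lam_eq_sign_of_isQuadraticBranchMinusLFunction (hp2 : p ≠ 2) (hf0 : IsNewform0 f)
    (hQ : coeffField f = ⊥) (hpN : ¬ p ∣ N) (hap : cuspCoeff f p = ((0 : ℤ) : ℂ)) {σ : ℤ} (hσ : σ ^ 2 = 1)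
    (hW : atkinLehnerInvolution N 2 N f = (-(σ : ℂ)) • f) {ϖ : ℚ} (hϖ : ‖(ϖ : ℚ_[p])‖ ≤ 1)
    {L : IwasawaAlgebra p} (hL : IsQuadraticBranchMinusLFunction f p ϖ L) (hL0 : L ≠ 0) :
    (-1 : ℤ) ^ lam L = σ * legendreSym p (-(N : ℤ)) := by
  have hP : p.Prime := hp.out
  set m : ℕ := lam L with hm
  obtain ⟨e, G, hG⟩ := exists_invol_sub_sign_mul_eq_of_isQuadraticBranchMinusLFunction hp2 hf0 hQ hpN hap hσ hW hϖ hL m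
  have hw := sign_eq_one_or (p := p) hpN hσ
  refine neg_one_pow_lam_eq_of_invol_sub_eq_mul hp2 hL0 hw (U := (1 + PowerSeries.X) ^ e)
    (by rw [map_pow, map_add, map_one, PowerSeries.constantCoeff_X, add_zero, one_pow]) (fun i hi ↦ ?_)
    (not_C_dvd_coe_X_mul_of_monic (monic_cyclotomicOmegaMinus p (2 * m + 1))) hG
  exact dvd_coeff_coe_X_mul_of_map_zmod_eq (SmallImageRttOneSided.map_zmod_cyclotomicOmegaMinus (2 * m + 1))
    (hi.trans ((Nat.le_succ _).trans (PollackPairK.le_natDegree_cyclotomicOmegaMinus p m)))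

/-- **`λ⁺ ≡ λ⁻ (mod 2)` — SIGN-FREE.** For any nonzero plus branch function `L⁺` and minus branch function `L⁻` of the same
`(f, p)` (period ratios `ϖ, ϖ'` both `p`-integral): `(−1)^{λ(L⁺)} = (−1)^{λ(L⁻)}`. [cite: MazurTateTeitelbaum1986Invent, §I.17]
[cite: Kobayashi2003, Thm. 3.2] -/
theorem neg_one_pow_lam_plus_eq_neg_one_pow_lam_minus (hp2 : p ≠ 2) (hf0 : IsNewform0 f)
    (hQ : coeffField f = ⊥) (hpN : ¬ p ∣ N) (hap : cuspCoeff f p = ((0 : ℤ) : ℂ))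
    {ϖ ϖ' : ℚ} (hϖ : ‖(ϖ : ℚ_[p])‖ ≤ 1) (hϖ' : ‖(ϖ' : ℚ_[p])‖ ≤ 1)
    {Lp Lm : IwasawaAlgebra p} (hLp : IsQuadraticBranchPlusLFunction f p ϖ Lp) (hLp0 : Lp ≠ 0)
    (hLm : IsQuadraticBranchMinusLFunction f p ϖ' Lm) (hLm0 : Lm ≠ 0) :
    (-1 : ℤ) ^ lam Lp = (-1) ^ lam Lm := by
  obtain ⟨σ, hσ, hW⟩ := exists_frickeSign_of_isNewform0 hf0
  rw [neg_one_pow_lam_eq_sign_of_isQuadraticBranchPlusLFunction hp2 hf0 hQ hpN hap hσ hW hϖ hLp hLp0,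
    neg_one_pow_lam_eq_sign_of_isQuadraticBranchMinusLFunction hp2 hf0 hQ hpN hap hσ hW hϖ' hLm hLm0]


/-! ## §13 Row currency: the crux's rows `V` (good at `p ≥ 5`, `a_p(V) = 0`), Mazur's `‖ϖ‖_p ≤ 1` -/

/-- **PARITY OF `λ⁺` AT A ROW.** `V` globally minimal, good at `p ≥ 5` with `a_p(V) = 0` (every row of crux 19606, CM or not, onto or not);
named fact `hM` (Mazur: the period ratio `ϖ` of the newform is `p`-integral). For the newform `f` of `V` (any level `N`; `p ∤ N` is automatic)
with Fricke sign `σ` (`w_N f = −σ f`; `σ = w_V` at `N = N_V`), every period ratio `ϖ` and every NONZERO plus branch function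
`Lη = L_p⁺(V, η, X)`: `(−1)^{λ(Lη)} = σ·(−N | p)`. [cite: MazurTateTeitelbaum1986Invent, §I.17] [cite: Kobayashi2003, Thm. 3.2, (3.4)]
[cite: Mazur1978, Cor. 4.1] -/
theorem neg_one_pow_lam_plus_row (hM : mazur_not_dvd_maninConstant_of_odd) (hp5 : 5 ≤ p)
    (V : WeierstrassCurve ℚ) [V.IsElliptic] [V.IsGloballyMinimal] (hgood : V.HasGoodReductionAtPrime p)
    (hap : V.frobeniusTrace p = 0) (hf : IsNewformOf V f) {σ : ℤ} (hσ : σ ^ 2 = 1)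
    (hW : atkinLehnerInvolution N 2 N f = (-(σ : ℂ)) • f) (ϖ : ℚ)
    (hrel : if Even (p / 2) then (ϖ : ℝ) * V.realPeriodRat = plusPeriod f
      else (ϖ : ℝ) * V.imaginaryPeriodRat = minusPeriod f)
    {Lη : IwasawaAlgebra p} (hL : IsQuadraticBranchPlusLFunction f p ϖ Lη) (hL0 : Lη ≠ 0) :
    (-1 : ℤ) ^ lam Lη = σ * legendreSym p (-(N : ℤ)) := by
  have hp2 : p ≠ 2 := by omega
  have hap' : cuspCoeff f p = ((0 : ℤ) : ℂ) := by
    rw [cuspCoeff_eq_frobeniusTrace_of_isNewformOf_holds hf hgood, hap]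
  exact neg_one_pow_lam_eq_sign_of_isQuadraticBranchPlusLFunction hp2 hf.1 hf.coeffField_eq_bot
    (not_dvd_level_of_isNewformOf hf hgood) hap' hσ hW (EtaMinusCoeffCongruence.norm_periodRatio_le_one_of_mazur p hM hp5 V f hf hgood hap ϖ hrel) hL hL0

/-- **PARITY OF `λ⁻` AT A ROW** (twin for `L_p⁻(V, η, X)`). [cite: MazurTateTeitelbaum1986Invent, §I.17] [cite: Kobayashi2003, Thm. 3.2, (3.5)]
[cite: Mazur1978, Cor. 4.1] -/
theorem neg_one_pow_lam_minus_row (hM : mazur_not_dvd_maninConstant_of_odd) (hp5 : 5 ≤ p)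
    (V : WeierstrassCurve ℚ) [V.IsElliptic] [V.IsGloballyMinimal] (hgood : V.HasGoodReductionAtPrime p)
    (hap : V.frobeniusTrace p = 0) (hf : IsNewformOf V f) {σ : ℤ} (hσ : σ ^ 2 = 1)
    (hW : atkinLehnerInvolution N 2 N f = (-(σ : ℂ)) • f) (ϖ : ℚ)
    (hrel : if Even (p / 2) then (ϖ : ℝ) * V.realPeriodRat = plusPeriod f
      else (ϖ : ℝ) * V.imaginaryPeriodRat = minusPeriod f)
    {Lη : IwasawaAlgebra p} (hL : IsQuadraticBranchMinusLFunction f p ϖ Lη) (hL0 : Lη ≠ 0) :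
    (-1 : ℤ) ^ lam Lη = σ * legendreSym p (-(N : ℤ)) := by
  have hp2 : p ≠ 2 := by omega
  have hap' : cuspCoeff f p = ((0 : ℤ) : ℂ) := by
    rw [cuspCoeff_eq_frobeniusTrace_of_isNewformOf_holds hf hgood, hap]
  exact neg_one_pow_lam_eq_sign_of_isQuadraticBranchMinusLFunction hp2 hf.1 hf.coeffField_eq_bot
    (not_dvd_level_of_isNewformOf hf hgood) hap' hσ hW (EtaMinusCoeffCongruence.norm_periodRatio_le_one_of_mazur p hM hp5 V f hf hgood hap ϖ hrel) hL hL0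

/-- **`λ⁺ ≡ λ⁻ (mod 2)` AT A ROW, SIGN-FREE**: for the newform of a row `V` and any period ratios, every nonzero plus branch function and
every nonzero minus branch function have `λ`-invariants of the same parity. [cite: MazurTateTeitelbaum1986Invent, §I.17]
[cite: Kobayashi2003, Thm. 3.2] [cite: Mazur1978, Cor. 4.1] -/
theorem neg_one_pow_lam_plus_eq_neg_one_pow_lam_minus_row (hM : mazur_not_dvd_maninConstant_of_odd) (hp5 : 5 ≤ p)
    (V : WeierstrassCurve ℚ) [V.IsElliptic] [V.IsGloballyMinimal] (hgood : V.HasGoodReductionAtPrime p)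
    (hap : V.frobeniusTrace p = 0) (hf : IsNewformOf V f) (ϖ ϖ' : ℚ)
    (hrel : if Even (p / 2) then (ϖ : ℝ) * V.realPeriodRat = plusPeriod f
      else (ϖ : ℝ) * V.imaginaryPeriodRat = minusPeriod f)
    (hrel' : if Even (p / 2) then (ϖ' : ℝ) * V.realPeriodRat = plusPeriod f
      else (ϖ' : ℝ) * V.imaginaryPeriodRat = minusPeriod f)
    {Lp Lm : IwasawaAlgebra p} (hLp : IsQuadraticBranchPlusLFunction f p ϖ Lp) (hLp0 : Lp ≠ 0)
    (hLm : IsQuadraticBranchMinusLFunction f p ϖ' Lm) (hLm0 : Lm ≠ 0) :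
    (-1 : ℤ) ^ lam Lp = (-1) ^ lam Lm := by
  obtain ⟨σ, hσ, hW⟩ := exists_frickeSign_of_isNewform0 hf.1
  rw [neg_one_pow_lam_plus_row hM hp5 V hgood hap hf hσ hW ϖ hrel hLp hLp0,
    neg_one_pow_lam_minus_row hM hp5 V hgood hap hf hσ hW ϖ' hrel' hLm hLm0]

end Branch

end Summit.BirchSwinnertonDyer.BirchSwinnertonDyer.Theorems.EtaThetaFunctionalEquation

end
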